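import Literature.AnabelianGeometry.EtaleTheta.ThetaSubquotientOfThetaSetting
import Literature.AnabelianGeometry.EtaleTheta.Discharge.Sec5ThetaSubquotientAutOntoOfRange
import Literature.AnabelianGeometry.EtaleTheta.DoubleUnderline
import Literature.AnabelianGeometry.SemiGraphs.TemperedDecompositionCompact

/-!
# [EtTh] §5, double underline case: the theta subquotients over `B^temp(Π^tp_X̲̲)⁰` — hypotheses of the
# explicit carriers and of the `Aut`-surjectivity DISCHARGED from Definition 2.5

Mochizuki, *The étale theta function and its Frobenioid-theoretic manifestations*, Publ. RIMS **45** (2009),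
§5 p. 322 (PDF p. 96) (the double underline case "`A`" `= X̲̲`: `D = B^temp(Π^tp_X̲̲)⁰`); §5 p. 327 (PDF p. 101):
"`(Π^tp_X)^Θ ⊇ l·Δ_Θ` … subquotients `Aut_D(D) ↠ Aut^Θ_D(D)`; `(l·Δ_Θ)_D ⊆ Aut^Θ_D(D)`"; Prop. 2.2 (ii) p. 263 / Prop. 2.12
(i) p. 271 (PDF pp. 37, 45): "`Δ_X̲̲ = Im(s_ι)`", "`Ker(Δ^Θ_* ↠ Δ^ell_*) = l·Δ_Θ`" — abc-iut-L2-t8's field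
`DoubleUnderline.map_toTheta_Huu : Π^tp_X̲̲^Θ ∩ Δ_Θ = l·Δ_Θ`.  [cite: MochizukiEtTh2009, §5 p.327 (PDF p.101)]
abc-iut cell, layer L2, seat abc-iut-L2-t9 (gen 3; unit W2-L2-05 lineage), sequel of the Q pin `ThetaSubquotientOfThetaSetting.lean`
(p434716) and of `Discharge/Sec5ThetaSubquotientAutOntoOfRange.lean`.  PROOF-ONLY (no `def`): the two standing hypotheses of
the generic explicit carrier `lDeltaQEquivOfSettingSub` and of the `Aut`-surjectivity at the base `U := Π^tp_X̲̲ = C.Huu` —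
`hU : IsTempered ↥Π^tp_X̲̲` and `hL : l·Δ_Θ ⊆ q(Π^tp_X̲̲)` — are THEOREMS of abc-iut-L2-t8's `EtaleThetaData.DoubleUnderline`
datum (given `Π^tp_X` tempered); nothing landed is edited or restated.

WHAT IS PROVED (`C : E.DoubleUnderline l` over `D : ThetaSetting p`; `q := (Π^tp_X ↠ (Π^tp_X)^Θ)|_{Π^tp_X̲̲}`, `L = l·Δ_Θ`).
* `ThetaSubquotient.range_qSub` — `q(U) = (U)^Θ := U.map (Π^tp_X ↠ (Π^tp_X)^Θ)` (bookkeeping, any `U`);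
* `DoubleUnderline.range_ιTheta_le_range_qSub_Huu` — **`l·Δ_Θ ⊆ (Π^tp_X̲̲)^Θ`** (field `map_toTheta_Huu`) in the shape `hL` of
  the generic theorems;
* `DoubleUnderline.isTempered_Huu` — `Π^tp_X̲̲` is tempered when `Π^tp_X` is (open subgroup; abc-iut-L3's
  `IsTempered.subgroup_of_isClosed`);
* **`DoubleUnderline.nonempty_lDelta_mulEquiv_Q`** — at every Galois object `Π^tp_X̲̲/N` of `B^temp(Π^tp_X̲̲)`:
  `(l·Δ_Θ)_{Π^tp_X̲̲/N} ≃* l·Δ_Θ ⧸ (l·Δ_Θ ∩ q(N))` (the generic `lDeltaQEquivOfSettingSub` with BOTH hypotheses discharged) —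
  print's `L·q(N)/q(N)`;
* **`DoubleUnderline.autProj_surjective_Q`** / `autProj_surjective_of_isGaloisObj` — print's `Aut`-subquotient
  `autPre ↠ (l·Δ_Θ)_A` is ONTO at every Galois object of `B^temp(Π^tp_X̲̲)` (`Π^tp_X̲̲/N`, resp. any Galois `A`) — the §5
  sentence "`(l·Δ_Θ)_D ⊆ Aut^Θ_D(D)`" for the double underline base with NO residual hypothesis beyond `Π^tp_X` tempered;
  `lDeltaQEquiv_autProj_surjective_Q` — composed with the explicit carrier;
* single underline case over `Π^tp_X` itself (`q` onto, field `toTheta_surjective`): `ThetaSetting.autProj_surjective_Q` /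
  `autProj_surjective_of_isGaloisObj`.

HONEST FRAMING: consequences of abc-iut-L2-t1's / abc-iut-L2-t8's DATA structures (`ThetaSetting`, `DoubleUnderline`), whose
fields quote [EtTh]; nothing asserts such data exist for an actual curve; `Π^tp_X` tempered is the hypothesis `hT` (as in every
§1 file); [EtTh] is refereed and nothing here bears on [IUTchIII] Cor. 3.12 — no side is taken; typed ≠ proved.
-/

noncomputable section

namespace Literature.AnabelianGeometry.EtaleTheta

open CategoryTheory Literature.AlgebraicGeometry.Frobenioids Literature.AnabelianGeometry.SemiGraphs
open Literature.AlgebraicGeometry.Frobenioids.QuasiTemperoid (stabilizerSubgroup)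
open scoped IsMulCommutative

/-! ### Bookkeeping on the pin's parameters -/

namespace ThetaSubquotient

variable {p : ℕ} [Fact p.Prime] (D : ThetaSetting p) (l : ℕ) (U : Subgroup D.PiTemp)

/-- `q(U) = U^Θ`, the image of `U` in `(Π^tp_X)^Θ`. [cite: MochizukiEtTh2009, §5 p.327 (PDF p.101)] -/
theorem range_qSub : (qSub D U).range = U.map D.toTheta := by
  rw [qSub, ← MonoidHom.map_range, Subgroup.range_subtype]

/-- `ι(l·Δ_Θ) = l·Δ_Θ`. [cite: MochizukiEtTh2009, §5 p.327 (PDF p.101)] -/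
theorem range_ιTheta : (ιTheta D l).range = D.lDeltaTheta l := Subgroup.range_subtype _

/-- `hL` for a subgroup `U` reads "`l·Δ_Θ ⊆ U^Θ`". [cite: MochizukiEtTh2009, §5 p.327 (PDF p.101)] -/
theorem range_ιTheta_le_range_qSub_iff : (ιTheta D l).range ≤ (qSub D U).range ↔ D.lDeltaTheta l ≤ U.map D.toTheta := by
  rw [range_qSub, range_ιTheta]

end ThetaSubquotient

/-! ### The double underline base `U := Π^tp_X̲̲` -/

namespace ThetaSetting

namespace EtaleThetaData.DoubleUnderline

variable {p : ℕ} [Fact p.Prime] {D : ThetaSetting p} {E : D.EtaleThetaData} {l : ℕ} (C : E.DoubleUnderline l)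

/-- **`l·Δ_Θ ⊆ (Π^tp_X̲̲)^Θ` in the shape `hL : L ≤ q(Π)` of the generic theorems, at `Π := Π^tp_X̲̲`**
("`Ker(Δ^Θ_* ↠ Δ^ell_*) = l·Δ_Θ`", Prop. 2.12 (i); field `map_toTheta_Huu`: `(Π^tp_X̲̲)^Θ ∩ Δ_Θ = l·Δ_Θ`; the bare
inclusion `l·Δ_Θ ≤ (Π^tp_X̲̲)^Θ` is already abc-iut-L6's `EtaleThetaDataOfSetting.lDeltaTheta_le_map_toTheta_Huu`, not
restated). [cite: MochizukiEtTh2009, Prop 2.12 (i) p.271 (PDF p.45)] -/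
theorem range_ιTheta_le_range_qSub_Huu :
    (ThetaSubquotient.ιTheta D l).range ≤ (ThetaSubquotient.qSub D C.Huu).range :=
  (ThetaSubquotient.range_ιTheta_le_range_qSub_iff D l C.Huu).2 (C.map_toTheta_Huu ▸ inf_le_left)

/-- `Π^tp_X̲̲` is tempered when `Π^tp_X` is (an open, hence closed, subgroup; abc-iut-L3's
`IsTempered.subgroup_of_isClosed`). [cite: MochizukiEtTh2009, §5 p.322 (PDF p.96)] -/
theorem isTempered_Huu (hT : IsTempered D.PiTemp) : IsTempered ↥C.Huu :=
  hT.subgroup_of_isClosed C.Huu (C.Huu.isClosed_of_isOpen C.isOpen_Huu)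

/-- **The theta subquotient at a Galois object `Π^tp_X̲̲/N` of the §5 base `B^temp(Π^tp_X̲̲)`, explicitly**:
`(l·Δ_Θ)_{Π^tp_X̲̲/N} ≃* l·Δ_Θ ⧸ (l·Δ_Θ ∩ q(N))` — print's `L·q(N)/q(N)` — abc-iut-L2-t9's generic
`lDeltaQEquivOfSettingSub` with both standing hypotheses DISCHARGED. [cite: MochizukiEtTh2009, §5 p.327 (PDF p.101)] -/
theorem nonempty_lDelta_mulEquiv_Q (hT : IsTempered D.PiTemp) (N : OpenNormalSubgroup ↥C.Huu) :
    Nonempty ((ThetaSubquotient.ofSettingSub D l C.Huu).lDelta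
        ⟨BTemp.Q (C.isTempered_Huu hT) N, ThetaSubquotient.isConnectedObj_Q (C.isTempered_Huu hT) N⟩ ≃*
      ↥(D.lDeltaTheta l) ⧸ (N.toSubgroup.map (ThetaSubquotient.qSub D C.Huu) ⊓ (ThetaSubquotient.ιTheta D l).range).comap
        (ThetaSubquotient.ιTheta D l)) :=
  ⟨ThetaSubquotient.lDeltaQEquivOfSettingSub D l C.Huu (C.isTempered_Huu hT) C.range_ιTheta_le_range_qSub_Huu N⟩

/-- **Print's `Aut`-subquotient is ONTO `(l·Δ_Θ)_{Π^tp_X̲̲/N}` at every Galois object `Π^tp_X̲̲/N`** ("`(l·Δ_Θ)_D ⊆ Aut^Θ_D(D)`"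
for the double underline base) — no residual hypothesis beyond `Π^tp_X` tempered.
[cite: MochizukiEtTh2009, §5 p.327 (PDF p.101)] -/
theorem autProj_surjective_Q (hT : IsTempered D.PiTemp) (N : OpenNormalSubgroup ↥C.Huu) :
    Function.Surjective (ThetaSubquotient.autProj (ThetaSubquotient.qSub D C.Huu) (ThetaSubquotient.ιTheta D l)
      (BTemp.Q (C.isTempered_Huu hT) N)) :=
  ThetaSubquotient.autProj_Q_surjective_of_range_le _ _ (C.isTempered_Huu hT) C.range_ιTheta_le_range_qSub_Huu N

/-- The same at an arbitrary Galois object `A` of `B^temp(Π^tp_X̲̲)` ([SemiAnbd] Def. 3.1 (iv)).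
[cite: MochizukiEtTh2009, §5 p.327 (PDF p.101)] -/
theorem autProj_surjective_of_isGaloisObj (hT : IsTempered D.PiTemp) (A : BTemp ↥C.Huu) (hA : IsGaloisObj A) :
    Function.Surjective (ThetaSubquotient.autProj (ThetaSubquotient.qSub D C.Huu) (ThetaSubquotient.ιTheta D l) A) :=
  ThetaSubquotient.autProj_surjective_of_isGaloisObj_of_range_le _ _ (C.isTempered_Huu hT) A hA
    C.range_ιTheta_le_range_qSub_Huu

/-- Composite: every class of `l·Δ_Θ ⧸ (l·Δ_Θ ∩ q(N))` is the image, through the explicit carrier, of an automorphism of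
`Π^tp_X̲̲/N` "given by `l·Δ_Θ`". [cite: MochizukiEtTh2009, §5 p.327 (PDF p.101)] -/
theorem lDeltaQEquiv_autProj_surjective_Q (hT : IsTempered D.PiTemp) (N : OpenNormalSubgroup ↥C.Huu) :
    Function.Surjective ((ThetaSubquotient.lDeltaQEquivOfSettingSub D l C.Huu (C.isTempered_Huu hT)
        C.range_ιTheta_le_range_qSub_Huu N).toMonoidHom.comp
      (ThetaSubquotient.autProj (ThetaSubquotient.qSub D C.Huu) (ThetaSubquotient.ιTheta D l)
        (BTemp.Q (C.isTempered_Huu hT) N))) :=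
  (ThetaSubquotient.lDeltaQEquivOfSettingSub D l C.Huu (C.isTempered_Huu hT)
      C.range_ιTheta_le_range_qSub_Huu N).surjective.comp (C.autProj_surjective_Q hT N)

end EtaleThetaData.DoubleUnderline

/-! ### The single underline base `Π^tp_X` (`q` onto) -/

variable {p : ℕ} [Fact p.Prime] (D : ThetaSetting p) (l : ℕ)

/-- At the Galois objects `Π^tp_X/N`: print's `Aut`-subquotient is onto `(l·Δ_Θ)_{Π^tp_X/N}` (`q = Π^tp_X ↠ (Π^tp_X)^Θ` onto).
[cite: MochizukiEtTh2009, §5 p.327 (PDF p.101)] -/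
theorem autProj_surjective_Q (hT : IsTempered D.PiTemp) (N : OpenNormalSubgroup D.PiTemp) :
    Function.Surjective (ThetaSubquotient.autProj D.toTheta (ThetaSubquotient.ιTheta D l) (BTemp.Q hT N)) :=
  ThetaSubquotient.autProj_Q_surjective_of_range_le _ _ hT (fun y _ => D.toTheta_surjective y) N

/-- At an arbitrary Galois object of `B^temp(Π^tp_X)`. [cite: MochizukiEtTh2009, §5 p.327 (PDF p.101)] -/
theorem autProj_surjective_of_isGaloisObj (hT : IsTempered D.PiTemp) (A : BTemp D.PiTemp) (hA : IsGaloisObj A) :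
    Function.Surjective (ThetaSubquotient.autProj D.toTheta (ThetaSubquotient.ιTheta D l) A) :=
  ThetaSubquotient.autProj_surjective_of_isGaloisObj _ _ hT A hA D.toTheta_surjective

end ThetaSetting

end Literature.AnabelianGeometry.EtaleTheta

end
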